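import Literature.NumberTheory.Sieve.ChenSieveProduct
import HarnessLib

/-!
# Mertens' estimate for Chen's `V_h(z)` with a FIXED shift `h`:
`∏_{p < z, p ∤ h} (1 − 1/(p − 1)) = 2 C_h e^{−γ}/log z · (1 + O(1/log z))`

Topic `Literature/NumberTheory/Sieve`; companion of `ChenSieveProduct.lean`. That file proves
Nathanson's Theorem 10.3 (corrected by the factor `2`) for the Goldbach problem, where the excluded
primes are those dividing the large even number `N` and the sieving level `z = N^{1/8}` grows with
`N`. In Chen's Theorem II (Chen Jing-run, Sci. Sinica 16 (1973), Thm II: `x_h(1,2) ≥ 0.67 x C_h/(log x)²`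
for the primes `p ≤ x` with `p + h = P₂`) the shift `h` is a FIXED even integer while the sieving level
`z = x^{1/10} → ∞`; the sifting density of the sequence `{p + h}` is `g(p) = 1/(p − 1)` for `p ∤ h`
and `0` for `p ∣ h`, so its Mertens product is `V_h(z) = Literature.NumberTheory.Sieve.Chen.sieveProduct h z`
and the constant of the main term is Chen's `C_h = Literature.NumberTheory.Sieve.Chen.singularSeries h`
(Chen 1973, §I: `C_x = ∏_{p ∣ x, p > 2} (p−1)/(p−2) ∏_{p > 2} (1 − 1/(p−1)²)`; (29) of the proof of
Lemma 9 is exactly this Mertens computation, quoted from Richert's (2.11)).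

This file PROVES the fixed-shift estimate, reusing the decomposition `V = 2 U T Q_z` and the three
error estimates of `ChenSieveProduct.lean` (Mertens' product theorem with rate, the tail of `C₂`);
the factor `R` of the large prime divisors is now trivially `1` as soon as `z > h`:

* `abs_sieveProduct_sub_le_of_lt` — for even `h ≠ 0`, `log z ≥ 50` and `z > h`:
  `|V_h(z) − 2 C_h e^{−γ}/log z| ≤ 117 · (2 C_h e^{−γ}/log z)/log z`;
* `eventually_sieveProduct_mem_Icc` — for every `ε > 0`, eventually in `z`,
  `(1 − ε) · 2 C_h e^{−γ}/log z ≤ V_h(z) ≤ (1 + ε) · 2 C_h e^{−γ}/log z`.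

No named facts; everything is unconditional.

## References

* Chen Jing-run, Sci. Sinica 16 (1973) 157–176, §I (definition of `C_x`) and (29) (reprint: Wang
  Yuan (ed.), *Goldbach Conjecture*, World Scientific 1984, PDF pp. 150, 167). [ChenSciSinica1973]
* M. B. Nathanson, *Additive Number Theory: The Classical Bases*, GTM 164 (1996), Thm 10.3 and its
  proof, pp. 170–171 of the held copy. [Nathanson1996]
-/

noncomputable section

open Finset Filter
open scoped Topology

namespace Literature.NumberTheory.Sieve.Chen

/-- **Mertens' estimate for `V_h(z)`, fixed even shift `h ≠ 0`** (Chen 1973, (29); Nathanson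
Thm 10.3 with `N` replaced by the fixed `h`): if `log z ≥ 50` and `z > h` then
`|V_h(z) − 2 C_h e^{−γ}/log z| ≤ 117 · (2 C_h e^{−γ}/log z)/log z`, where
`V_h(z) = ∏_{p<z, p∤h} (1 − 1/(p−1))` (`sieveProduct h z`) and `C_h = singularSeries h`.
Proof: `V_h(z) = 2 U T Q_z` (`sieveProduct_eq_mul`) with `Q_z = ∏_{p ∣ h, p > 2} (p−1)/(p−2) = C_h/C₂`
because every prime factor of `h` is `< z`; `|U e^γ log z − 1| ≤ 50/log z`
(`abs_mertensFactor_sub_one_le`) and `1 ≤ T/C₂ ≤ 1 + 1/log z` (tail of `C₂`).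
[cite: ChenSciSinica1973, Lemma 9 eq. (29) (reprint p. 167)] -/
theorem abs_sieveProduct_sub_le_of_lt {h : ℕ} (hEven : Even h) (hh0 : h ≠ 0) {w : ℝ}
    (hL50 : 50 ≤ Real.log w) (hhw : (h : ℝ) < w) :
    |sieveProduct h w - 2 * singularSeries h * Real.exp (-Real.eulerMascheroniConstant) / Real.log w| ≤
      117 * (2 * singularSeries h * Real.exp (-Real.eulerMascheroniConstant) / Real.log w) /
        Real.log w := by
  set L := Real.log w with hLdef
  have hL0 : 0 < L := by linarith
  have hw1 : (1 : ℝ) < w :=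
    lt_of_le_of_lt (by exact_mod_cast Nat.one_le_iff_ne_zero.mpr hh0) hhw
  have hwpos : 0 < w := by linarith
  have hwL : L + 2 ≤ w := by
    rw [← Real.exp_log hwpos]
    have := Real.quadratic_le_exp_of_nonneg hL0.le
    nlinarith
  have hw2 : 2 < w := by linarith
  -- the pieces
  set Z := ⌈w⌉₊ with hZ
  set U := ∏ p ∈ Nat.primesBelow Z, (1 - (p : ℝ)⁻¹) with hU
  set T := ∏ p ∈ (Nat.primesBelow Z).filter (2 < ·), (1 - 1 / ((p : ℝ) - 1) ^ 2) with hT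
  set Qz := ∏ p ∈ (h.primeFactors.filter (2 < ·)).filter (· < Z),
    ((p : ℝ) - 1) / ((p : ℝ) - 2) with hQz
  have hV : sieveProduct h w = 2 * U * T * Qz := sieveProduct_eq_mul hEven hh0 hw2
  -- all prime factors of `h` are `< Z`: the factor `R` of `singularSeries_eq_mul` is an empty product
  have hempty : (h.primeFactors.filter (2 < ·)).filter (fun p : ℕ => ¬p < Z) = ∅ := by
    refine Finset.filter_eq_empty_iff.mpr fun p hp hnot => hnot ?_
    have hp' : p ∈ h.primeFactors := (Finset.mem_filter.mp hp).1
    have hple : p ≤ h := Nat.le_of_mem_primeFactors hp'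
    have hlt : (p : ℝ) < Z :=
      calc (p : ℝ) ≤ h := by exact_mod_cast hple
        _ < w := hhw
        _ ≤ Z := Nat.le_ceil _
    exact_mod_cast hlt
  have hS : singularSeries h = twinPrimeConst * Qz := by
    rw [singularSeries_eq_mul h Z, hempty, Finset.prod_empty, mul_one]
  -- `α = U e^γ L`
  have hα : |U * (Real.exp Real.eulerMascheroniConstant * L) - 1| ≤ 50 / L :=
    abs_mertensFactor_sub_one_le hw2.le (by linarith)
  -- `β = T/C₂`
  have hC2 : 0 < twinPrimeConst := twinPrimeConst_pos_holds
  have hZw : w ≤ Z := Nat.le_ceil _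
  have h3Z : 3 ≤ Z := by
    have : (3 : ℝ) ≤ Z := by linarith
    exact_mod_cast this
  have hTdef : T = twinPrimeConstPartial (Z - 1) := by
    rw [hT, twinPrimeConstPartial, Nat.primesBelow_eq_primesLE_sub_one]
  have hC2T : twinPrimeConst ≤ T := hTdef ▸ twinPrimeConst_le_twinPrimeConstPartial _
  have hx : (((Z - 1 : ℕ) : ℝ)) = (Z : ℝ) - 1 := by
    rw [Nat.cast_sub (by omega)]; norm_num
  have hTC2 : T * (((Z : ℝ) - 1 - 1) / ((Z : ℝ) - 1)) ≤ twinPrimeConst := by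
    have h1 := twinPrimeConstPartial_mul_le_twinPrimeConst (x := Z - 1) (by omega)
    rwa [← hTdef, hx] at h1
  have hβ1 : 1 ≤ T / twinPrimeConst := (one_le_div hC2).mpr hC2T
  have hβ2 : T / twinPrimeConst - 1 ≤ 1 / L := by
    have hZ2 : L ≤ (Z : ℝ) - 2 := by linarith
    have hZ2pos : 0 < (Z : ℝ) - 2 := by linarith
    have h1 : T * ((Z : ℝ) - 2) ≤ twinPrimeConst * ((Z : ℝ) - 1) := by
      have h2 := hTC2
      rw [show (Z : ℝ) - 1 - 1 = (Z : ℝ) - 2 by ring, mul_div_assoc', div_le_iff₀ (by linarith)]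
        at h2
      exact h2
    calc T / twinPrimeConst - 1 = (T - twinPrimeConst) / twinPrimeConst := by field_simp
      _ ≤ 1 / ((Z : ℝ) - 2) := by
          rw [div_le_div_iff₀ hC2 hZ2pos]
          nlinarith
      _ ≤ 1 / L := one_div_le_one_div_of_le hL0 hZ2
  -- the identity `V · 1 = M α β` and the bookkeeping of `ChenSieveProduct`
  set M := 2 * singularSeries h * Real.exp (-Real.eulerMascheroniConstant) / L with hM
  have hMpos : 0 < M := by
    have := singularSeries_pos h
    positivity
  have hVR : sieveProduct h w * 1 =
      M * (U * (Real.exp Real.eulerMascheroniConstant * L)) * (T / twinPrimeConst) := by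
    rw [hV, hM, hS, Real.exp_neg]
    field_simp
  have hR1 : (1 : ℝ) ≤ 1 := le_rfl
  have hR2 : (1 : ℝ) - 1 ≤ 16 / L := by
    rw [sub_self]
    positivity
  exact abs_sub_le_of_relErrors hMpos hL50 hVR hα hβ1 hβ2 hR1 hR2

/-- **`V_h(z) ∼ 2 C_h e^{−γ}/log z`, two-sided with any relative error**: for even `h ≠ 0` and every
`ε > 0`, for all large `z`,
`(1 − ε) · 2 C_h e^{−γ}/log z ≤ V_h(z) ≤ (1 + ε) · 2 C_h e^{−γ}/log z`
(from `abs_sieveProduct_sub_le_of_lt` once `log z ≥ max(50, 117/ε)` and `z > h`). This is the form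
in which Chen's proof uses (29) at `z = x^{1/10}` (lower bound (31)) and at the levels of the upper
bounds (32) and Lemma 8. [cite: ChenSciSinica1973, Lemma 9 eq. (29) (reprint p. 167)] -/
theorem eventually_sieveProduct_mem_Icc {h : ℕ} (hEven : Even h) (hh0 : h ≠ 0) {ε : ℝ}
    (hε : 0 < ε) :
    ∀ᶠ w : ℝ in atTop,
      (1 - ε) * (2 * singularSeries h * Real.exp (-Real.eulerMascheroniConstant) / Real.log w) ≤
          sieveProduct h w ∧
        sieveProduct h w ≤
          (1 + ε) * (2 * singularSeries h * Real.exp (-Real.eulerMascheroniConstant) / Real.log w) := by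
  filter_upwards [Real.tendsto_log_atTop.eventually_ge_atTop (max 50 (117 / ε)),
    eventually_gt_atTop (h : ℝ)] with w hw hhw
  have hL50 : 50 ≤ Real.log w := le_trans (le_max_left _ _) hw
  have hLε : 117 / ε ≤ Real.log w := le_trans (le_max_right _ _) hw
  have hL0 : 0 < Real.log w := by linarith
  set M := 2 * singularSeries h * Real.exp (-Real.eulerMascheroniConstant) / Real.log w with hM
  have hMpos : 0 < M := by
    have := singularSeries_pos h
    positivity
  have habs := abs_sieveProduct_sub_le_of_lt hEven hh0 hL50 hhw
  rw [← hM] at habs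
  have hrat : 117 * M / Real.log w ≤ ε * M := by
    rw [div_le_iff₀ hL0]
    have h1 : 117 ≤ ε * Real.log w := by
      rw [div_le_iff₀ hε] at hLε
      linarith
    nlinarith
  have h := abs_le.mp (habs.trans hrat)
  constructor <;> nlinarith [h.1, h.2]

end Literature.NumberTheory.Sieve.Chen
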